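import Summits.BirchSwinnertonDyer.Rank1Residual.X11b.Three.UnramifiedClassCoboundary
import Summits.BirchSwinnertonDyer.Rank1Residual.X11b.Three.UnramifiedClassNodeLift
import HarnessLib

/-!
# X11b at `p = 3` (team N8/O2), S15 (iii)(b/c): unramified `E₀`-valued classes of `H¹(K_v, E)`
# vanish at a place of MULTIPLICATIVE reduction (Milne ADT I.3.8 for `𝒜°` at a node)

HONEST FRAMING (cell `b2b-bsdres`, run/shared/lean/b2b/bsd-rank1-residual/, verbatim in every
file): the goal of the cell is to DELETE the COMBINATION-SHAPED residual classes of the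
Birch–Swinnerton-Dyer formula for ALL analytic-rank `≤ 1` elliptic curves over `ℚ` — "full BSD
formula for every rank `≤ 1` curve in class `C`" assembled STRICTLY from published theorems — so
that the rank-`≤ 1` remainder becomes exactly the CONSTRUCTION-SHAPED classes, which are TYPED
(missing-input `Prop`s), NOT attempted. This is not "finishing BSD". Team N8/O2 = `x11b3`, seat
`b2b-bsdres-x11b3-p8` (GEN 3), LEAD DEAL #7 (R7-7) S15 (iii)(b/c): the "instantiation facts" for
the unramified layers. LABEL OF RECORD: flag-discharge hygiene for `JET@p|N` (harvest E66 (D)) —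
NOT count-moving; nothing is booked; `O2` OPEN. THEOREMS ONLY: no definition, no named fact, no
`sorry`.

## What

Milne, *Arithmetic Duality Theorems*, Prop. I.3.8 — "`H¹(G/I, 𝒜°(R^{un})) = 0`" — for the
identity component `𝒜° = E₀` of an elliptic curve with MULTIPLICATIVE reduction, in the
`K̄_v`-currency of `SelmerInertia` / `PeriodIndexSupport` (`K_v = v.adicCompletion K`,
`Γ_{K_v} = Gal(K̄_v/K_v)` acting on `E(K̄_v) = localPoints W K_v`, the prime `𝔐` of `\bar 𝓞_v`
above `𝓂_v` and its inertia group `I_𝔐`; `H¹(K_v, E) = H¹_cont(Γ_{K_v}, E(K̄_v))` with its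
`oneCocycleClass`), assembled from the cell's `UnramifiedClassCoboundary` (Steps 2–4 of the tree's
proof `PeriodIndexSupportProofs.exists_eq_map_sub_of_cocycle`, reduction-type free) and
`UnramifiedClassNodeLift` (Step 1 at a node):

* `exists_eq_map_sub_of_cocycle_of_hasMultiplicativeReductionAt` (model form): for `W/K` elliptic
  with multiplicative reduction at `v`, `M = W.localMinimalIntegralModel v`, `V = M ⊗ K̄_v`,
  `ι : 𝓞_v → 𝒪_w` the structure map into the valuation ring of the spectral valuation, every
  crossed homomorphism `g : Γ_{K_v} → V(K̄_v)` with open zero set, vanishing on `I_𝔐`, and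
  `E₀`-VALUED (each `g σ` has nonsingular reduction on `M.map ι`) is principal: `g = ∂P`.
* `oneCocycleClass_eq_zero_of_hasMultiplicativeReductionAt_of_forall` (curve form, the shape of
  the tree's `Milne2006_unramifiedClass_eq_zero` with the `E₀`-condition added): every continuous
  crossed homomorphism `f : Γ_{K_v} → E(K̄_v)` vanishing on `I_𝔐` whose values, transported to
  `V(K̄_v)` along the tree's equivariant transport `Φ` (`congrEquiv (baseChange_baseChange_adicCompletion W v).symm`,
  `VariableChange.pointEquivBaseChange _ C`, `congrEquiv` for `C • W_{K_v} = M ⊗ K_v`, as in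
  `Milne2006_unramifiedClass_eq_zero_holds`), have nonsingular reduction, has trivial class.
* `oneCocycleClass_eq_zero_of_hasMultiplicativeReductionAt` (subgroup form = the hypothesis
  **`hvanish`** of x11b3-p1's END FORM `kolyvaginClass_kolyvaginPoint_mem_selmerLocalKer_of_GZ31`,
  p254200, for every `B ≤ E(K̄_v)` contained in `E₀`): `(∀ τ, f τ ∈ B) → (∀ τ ∈ I_𝔐, f τ = 0) →
  oneCocycleClass f = 0`.

No residual "instantiation" hypothesis (`hcard`, `hfrob`, `hφ`, `hn`, `hφw`, `IsAdicComplete` of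
the finite-layer chain p4 `GoodReductionSubgroupFormalH1` / p3 / p8 `MultiplicativeNodePresentation`)
remains: the Frobenius, the unramified layers `K_v(ζ_{qⁿ-1})`, their completeness and residue
fields are the tree's (`exists_isArithFrobAt_localAbsIntegers`, `UnramifiedLayerRootsProofs`,
`UnramifiedCoboundaryInputs`, `LocalFrobeniusGenerationProofs`). The data `w`, `ι`, `C` are the
tree's existential witnesses (`exists_spectralValuation`, `exists_ringHom_adicCompletionIntegers_integer`,
`exists_variableChange_eq_localMinimalIntegralModel`), taken as parameters so that "`E₀`-valued"
can be SAID; the finite-layer chain (i)/(ii)/(iii)(a) remains the road in the LAYER currency of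
p1's `JetchevKummerAtP` (`T = ι(t₀ + p^m t₁)`), untouched.

HONEST CONSEQUENCE (LEAD R7-16a (3), verbatim division of labour): these theorems do NOT discharge
`JET@p|N` by themselves. They say `H¹(K_v^{nr}/K_v, E₀) → H¹(K_v, E)` is zero at multiplicative `v`
for `E₀`-VALUED cocycles; the entire `c_v` / component-group content of Jetchev 2008 Prop. 4.1 at
`v ∣ p` is pushed into the (iv)/(A)/(B) step "the (twisted-layer) Kolyvagin cocycle is `E₀`-valued"
— x11b3-p1's assembly, where the published input [GZ86, III (3.1)] ("`y_n ∈ E⁰ + E(ℚ)_tors` at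
every `w ∣ N`", Gross 1991 p. 245) is the labelled binder `hGZ31`. No Tamagawa hypothesis appears
here precisely BECAUSE the receptacle is `B ⊆ E₀` and not `E`: for `E` itself the obstruction is
`H¹(k_v, Φ_v)` (the component group), where `3 ∣ c_v` would bite. The flag stays; nothing is booked.

References (locators only; no cited FACT): [cite: MilneADT2006, Ch. I Prop. 3.8 (and its proof;
Notes to §I.3)] [cite: SilvermanAEC2009, Prop. VII.2.1, Prop. III.2.5(a), Exercise 3.5(a)]
[cite: GrossLMS1991, Prop. 6.2 (1), p. 244 ("`H¹(K_λ^{un}/K_λ, E⁰) = 0`")]; cell files p255910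
(`UnramifiedClassCoboundary`), `UnramifiedClassNodeLiftInputs`, `UnramifiedClassNodeLift`.

## Design

`noncomputable section`; no definitions; no local notation. Namespace
`Summit.BirchSwinnertonDyer.Rank1Residual.X11b.Three.UnramifiedNode`. Axioms: `propext`,
`Classical.choice`, `Quot.sound`.
-/

noncomputable section

open scoped Classical NNReal Topology
open NumberField IsDedekindDomain Field Polynomial ValuativeRel

universe u

namespace Summit.BirchSwinnertonDyer.Rank1Residual.X11b.Three.UnramifiedNode

open WeierstrassCurve Literature.NumberTheory.EllipticCurves
  Literature.NumberTheory.EllipticCurves.FormalGroupChart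
  Literature.NumberTheory.GaloisRepresentations
  Literature.NumberTheory.GaloisRepresentations.IsNonarchimedeanLocalField IsDedekindDomain.HeightOneSpectrum

variable {K : Type u} [Field K] [NumberField K] (W : WeierstrassCurve K) {v : HeightOneSpectrum (𝓞 K)}
  {w : Valuation (AlgebraicClosure (v.adicCompletion K)) ℝ≥0}
  (hw : ∀ x, (w x : ℝ) = spectralNorm (v.adicCompletion K) (AlgebraicClosure (v.adicCompletion K)) x)
  {ι : v.adicCompletionIntegers K →+* w.integer}
  (hι : ∀ a, ((ι a : w.integer) : AlgebraicClosure (v.adicCompletion K)) =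
    algebraMap (v.adicCompletion K) (AlgebraicClosure (v.adicCompletion K)) (a : v.adicCompletion K))

/-! ### §1 Model form: `E₀`-valued unramified crossed homomorphisms into `V(K̄_v)` are principal -/

include hw in
/-- **Milne ADT I.3.8 for `E₀` at a place of multiplicative reduction, model form.** For `W/K`
elliptic with multiplicative reduction at `v`, every crossed homomorphism
`g : Γ_{K_v} → V(K̄_v)` (`V = M ⊗ K̄_v`, `M = W.localMinimalIntegralModel v`) with open zero set,
vanishing on the inertia group `I_𝔐`, and with values of nonsingular reduction on the
`𝒪_w`-model `M.map ι` (`E₀`-valued), is principal: `g σ = σP - P`. Assembly of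
`exists_eq_map_sub_of_cocycle_of_lift` (Steps 2–4) with the node lift
`exists_lift_sub_mem_kernel_of_hasMultiplicativeReductionAt` (Step 1).
[cite: MilneADT2006, Ch. I Prop. 3.8] [cite: GrossLMS1991, Prop. 6.2 (1), p. 244] -/
theorem exists_eq_map_sub_of_cocycle_of_hasMultiplicativeReductionAt [W.IsElliptic]
    (hmult : W.HasMultiplicativeReductionAt v)
    {𝔐 : Ideal v.localAbsIntegers} (h𝔐 : 𝔐 ∈ v.localPrimesAbove)
    [hV : ((((W.localMinimalIntegralModel v).map (algebraMap (v.adicCompletionIntegers K) (v.adicCompletion K))).baseChange (AlgebraicClosure (v.adicCompletion K)))).IsIntegral w.integer]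
    (hι : ∀ a, ((ι a : w.integer) : AlgebraicClosure (v.adicCompletion K)) =
      algebraMap (v.adicCompletion K) (AlgebraicClosure (v.adicCompletion K)) (a : v.adicCompletion K))
    (g : absoluteGaloisGroup (v.adicCompletion K) → ((((W.localMinimalIntegralModel v).map (algebraMap (v.adicCompletionIntegers K) (v.adicCompletion K))).baseChange (AlgebraicClosure (v.adicCompletion K)))).toAffine.Point)
    (hg : ∀ σ τ, g (σ * τ) = g σ + WeierstrassCurve.Affine.Point.map (W' := (W.localMinimalIntegralModel v).map (algebraMap (v.adicCompletionIntegers K) (v.adicCompletion K))) ((absoluteGaloisGroup.toAlgEquiv (v.adicCompletion K) (σ) : AlgebraicClosure (v.adicCompletion K) ≃ₐ[v.adicCompletion K] AlgebraicClosure (v.adicCompletion K)) : AlgebraicClosure (v.adicCompletion K) →ₐ[v.adicCompletion K] AlgebraicClosure (v.adicCompletion K)) (g τ))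
    (hopen : IsOpen {σ | g σ = 0})
    (hI : ∀ τ ∈ 𝔐.inertia (absoluteGaloisGroup (v.adicCompletion K)), g τ = 0)
    (hE₀ : ∀ σ, ((W.localMinimalIntegralModel v).map ι).HasNonsingularReduction
      (Affine.Point.congrEquiv (baseChange_map_eq_baseChange_map hι (W.localMinimalIntegralModel v)) (g σ))) :
    ∃ P : ((((W.localMinimalIntegralModel v).map (algebraMap (v.adicCompletionIntegers K) (v.adicCompletion K))).baseChange (AlgebraicClosure (v.adicCompletion K)))).toAffine.Point, ∀ σ, g σ = WeierstrassCurve.Affine.Point.map (W' := (W.localMinimalIntegralModel v).map (algebraMap (v.adicCompletionIntegers K) (v.adicCompletion K))) ((absoluteGaloisGroup.toAlgEquiv (v.adicCompletion K) (σ) : AlgebraicClosure (v.adicCompletion K) ≃ₐ[v.adicCompletion K] AlgebraicClosure (v.adicCompletion K)) : AlgebraicClosure (v.adicCompletion K) →ₐ[v.adicCompletion K] AlgebraicClosure (v.adicCompletion K)) P - P :=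
  exists_eq_map_sub_of_cocycle_of_lift W hw h𝔐 g hg hopen hI fun φ hφq ↦
    exists_lift_sub_mem_kernel_of_hasMultiplicativeReductionAt W hw hmult h𝔐 hι hφq (g φ) (hE₀ φ)

/-! ### §2 Curve form: `E₀`-valued unramified classes of `H¹(K_v, E)` vanish -/

include hw in
/-- **Milne ADT I.3.8 for `E₀` at a place of multiplicative reduction, curve form** (the shape of
the tree's `Milne2006_unramifiedClass_eq_zero` with the `E₀`-condition): a continuous crossed
homomorphism `f : Γ_{K_v} → E(K̄_v) = localPoints W K_v` vanishing on `I_𝔐`, all of whose values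
have nonsingular reduction on the minimal model (read through the tree's equivariant transport
`Φ : E(K̄_v) ≃ V(K̄_v)` of `Milne2006_unramifiedClass_eq_zero_holds`, determined by the variable
change `C` to the minimal model, and the `𝒪_w`-model along `ι`), has trivial class in
`H¹(K_v, E)`. The spectral valuation `w`, the structure map `ι` and `C` are the tree's witnesses
(`exists_spectralValuation`, `exists_ringHom_adicCompletionIntegers_integer`,
`exists_variableChange_eq_localMinimalIntegralModel`). [cite: MilneADT2006, Ch. I Prop. 3.8]
[cite: GrossLMS1991, Prop. 6.2 (1), p. 244] -/
theorem oneCocycleClass_eq_zero_of_hasMultiplicativeReductionAt_of_forall [W.IsElliptic]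
    (hmult : W.HasMultiplicativeReductionAt v)
    {𝔐 : Ideal v.localAbsIntegers} (h𝔐 : 𝔐 ∈ v.localPrimesAbove)
    (hι : ∀ a, ((ι a : w.integer) : AlgebraicClosure (v.adicCompletion K)) =
      algebraMap (v.adicCompletion K) (AlgebraicClosure (v.adicCompletion K)) (a : v.adicCompletion K))
    {C : VariableChange (v.adicCompletion K)}
    (hC : C • W.baseChange (v.adicCompletion K) =
      (W.localMinimalIntegralModel v).map (algebraMap (v.adicCompletionIntegers K) (v.adicCompletion K)))
    (f : contOneCocycles (discreteTopRep (absoluteGaloisGroup (v.adicCompletion K))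
      (localPoints W (v.adicCompletion K))))
    (hfE₀ : ∀ σ, ((W.localMinimalIntegralModel v).map ι).HasNonsingularReduction
      (Affine.Point.congrEquiv (baseChange_map_eq_baseChange_map hι (W.localMinimalIntegralModel v))
        (Affine.Point.congrEquiv (congrArg (fun X : WeierstrassCurve (v.adicCompletion K) ↦
            X.baseChange (AlgebraicClosure (v.adicCompletion K))) hC)
          (VariableChange.pointEquivBaseChange (W.baseChange (v.adicCompletion K)) C
            (AlgebraicClosure (v.adicCompletion K))
            (Affine.Point.congrEquiv (baseChange_baseChange_adicCompletion W v).symm (f.1 σ))))))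
    (hfI : ∀ τ ∈ 𝔐.inertia (absoluteGaloisGroup (v.adicCompletion K)), f.1 τ = 0) :
    oneCocycleClass (discreteTopRep (absoluteGaloisGroup (v.adicCompletion K))
      (localPoints W (v.adicCompletion K))) f = 0 := by
  haveI := WeierstrassCurve.isIntegral_spectralValuation_baseChange hw (W.localMinimalIntegralModel v)
  have hC' := congrArg (fun X : WeierstrassCurve (v.adicCompletion K) ↦
    X.baseChange (AlgebraicClosure (v.adicCompletion K))) hC
  -- the equivariant transport `E(K̄_v) ≃ V(K̄_v)` (as in `Milne2006_unramifiedClass_eq_zero_holds`)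
  let Φ : localPoints W (v.adicCompletion K) ≃+
      (((W.localMinimalIntegralModel v).map (algebraMap (v.adicCompletionIntegers K)
        (v.adicCompletion K))).baseChange (AlgebraicClosure (v.adicCompletion K))).toAffine.Point :=
    ((WeierstrassCurve.Affine.Point.congrEquiv (WeierstrassCurve.baseChange_baseChange_adicCompletion W v).symm).trans
      (WeierstrassCurve.VariableChange.pointEquivBaseChange (W.baseChange (v.adicCompletion K)) C
        (AlgebraicClosure (v.adicCompletion K)))).trans
      (WeierstrassCurve.Affine.Point.congrEquiv hC')
  have hΦ : ∀ (σ : absoluteGaloisGroup (v.adicCompletion K)) (Q : localPoints W (v.adicCompletion K)),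
      Φ (σ • Q) = WeierstrassCurve.Affine.Point.map ((absoluteGaloisGroup.toAlgEquiv (v.adicCompletion K) σ :
          AlgebraicClosure (v.adicCompletion K) ≃ₐ[v.adicCompletion K] AlgebraicClosure (v.adicCompletion K)) :
          AlgebraicClosure (v.adicCompletion K) →ₐ[v.adicCompletion K] AlgebraicClosure (v.adicCompletion K))
        (Φ Q) := by
    intro σ Q
    change WeierstrassCurve.Affine.Point.congrEquiv hC' (WeierstrassCurve.VariableChange.pointEquivBaseChange (W.baseChange (v.adicCompletion K)) C
        (AlgebraicClosure (v.adicCompletion K))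
        (WeierstrassCurve.Affine.Point.congrEquiv (WeierstrassCurve.baseChange_baseChange_adicCompletion W v).symm (σ • Q))) =
      WeierstrassCurve.Affine.Point.map _ (WeierstrassCurve.Affine.Point.congrEquiv hC'
        (WeierstrassCurve.VariableChange.pointEquivBaseChange (W.baseChange (v.adicCompletion K)) C
          (AlgebraicClosure (v.adicCompletion K))
          (WeierstrassCurve.Affine.Point.congrEquiv (WeierstrassCurve.baseChange_baseChange_adicCompletion W v).symm Q)))
    rw [WeierstrassCurve.congrEquiv_smul, WeierstrassCurve.VariableChange.pointEquivBaseChange_map_algEquiv]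
    exact WeierstrassCurve.Affine.Point.congrEquiv_baseChange_map hC _ _
  -- the transported crossed homomorphism
  set g : absoluteGaloisGroup (v.adicCompletion K) → _ := fun σ ↦ Φ (f.1 σ) with hgdef
  have hg : ∀ σ τ, g (σ * τ) = g σ + WeierstrassCurve.Affine.Point.map ((absoluteGaloisGroup.toAlgEquiv (v.adicCompletion K) σ :
      AlgebraicClosure (v.adicCompletion K) ≃ₐ[v.adicCompletion K] AlgebraicClosure (v.adicCompletion K)) :
      AlgebraicClosure (v.adicCompletion K) →ₐ[v.adicCompletion K] AlgebraicClosure (v.adicCompletion K)) (g τ) := by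
    intro σ τ
    simp only [hgdef]
    rw [f.2 σ τ, map_add, discreteTopRep_ρ_apply, hΦ]
  have hopen : IsOpen {σ | g σ = 0} := by
    have e : {σ | g σ = 0} = f.1 ⁻¹' {0} := by
      ext σ
      simp only [hgdef, Set.mem_setOf_eq, Set.mem_preimage, Set.mem_singleton_iff]
      exact Φ.map_eq_zero_iff
    rw [e]
    exact (isOpen_discrete _).preimage f.1.continuous
  have hI : ∀ τ ∈ 𝔐.inertia (absoluteGaloisGroup (v.adicCompletion K)), g τ = 0 := fun τ hτ ↦ by
    simp only [hgdef, hfI τ hτ, map_zero]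
  have hE₀ : ∀ σ, ((W.localMinimalIntegralModel v).map ι).HasNonsingularReduction
      (Affine.Point.congrEquiv (baseChange_map_eq_baseChange_map hι (W.localMinimalIntegralModel v)) (g σ)) :=
    fun σ ↦ hfE₀ σ
  obtain ⟨P, hP⟩ := exists_eq_map_sub_of_cocycle_of_hasMultiplicativeReductionAt W hw hmult h𝔐 hι g hg hopen hI hE₀
  rw [oneCocycleClass_eq_zero_iff]
  refine ⟨Φ.symm P, fun σ ↦ Φ.injective ?_⟩
  rw [discreteTopRep_ρ_apply, map_sub, hΦ, AddEquiv.apply_symm_apply]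
  exact hP σ

include hw in
/-- **`hvanish` of the END FORM, as a theorem at multiplicative places** (Milne ADT I.3.8 for
`𝒜° = E₀`; Gross 1991 p. 244, "`H¹(K_λ^{un}/K_λ, E⁰) = 0`"): for every subgroup `B ≤ E(K̄_v)`
consisting of points with nonsingular reduction on the minimal model at `v` (read through the
transport `Φ`), every continuous crossed homomorphism `f : Γ_{K_v} → E(K̄_v)` with values in `B`
and vanishing on the inertia group `I_𝔐` has trivial class in `H¹(K_v, E)` — the hypothesis
`hvanish` of x11b3-p1's `kolyvaginClass_kolyvaginPoint_mem_selmerLocalKer_of_GZ31` (p254200) for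
`B ⊆ E⁰(K̄_v)`, with no residual layer hypothesis. It does NOT discharge `JET@p|N`: that the
Kolyvagin cocycle IS `B`-valued is the (iv)/(A)/(B) step (binder `hGZ31`, [GZ86, III (3.1)]), where
all the `c_v` / component-group content lives (LEAD R7-16a (3)). [cite: MilneADT2006, Ch. I Prop. 3.8]
[cite: GrossLMS1991, Prop. 6.2 (1), pp. 244–245] -/
theorem oneCocycleClass_eq_zero_of_hasMultiplicativeReductionAt [W.IsElliptic]
    (hmult : W.HasMultiplicativeReductionAt v)
    {𝔐 : Ideal v.localAbsIntegers} (h𝔐 : 𝔐 ∈ v.localPrimesAbove)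
    (hι : ∀ a, ((ι a : w.integer) : AlgebraicClosure (v.adicCompletion K)) =
      algebraMap (v.adicCompletion K) (AlgebraicClosure (v.adicCompletion K)) (a : v.adicCompletion K))
    {C : VariableChange (v.adicCompletion K)}
    (hC : C • W.baseChange (v.adicCompletion K) =
      (W.localMinimalIntegralModel v).map (algebraMap (v.adicCompletionIntegers K) (v.adicCompletion K)))
    (B : AddSubgroup (localPoints W (v.adicCompletion K)))
    (hB : ∀ Q ∈ B, ((W.localMinimalIntegralModel v).map ι).HasNonsingularReduction
      (Affine.Point.congrEquiv (baseChange_map_eq_baseChange_map hι (W.localMinimalIntegralModel v))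
        (Affine.Point.congrEquiv (congrArg (fun X : WeierstrassCurve (v.adicCompletion K) ↦
            X.baseChange (AlgebraicClosure (v.adicCompletion K))) hC)
          (VariableChange.pointEquivBaseChange (W.baseChange (v.adicCompletion K)) C
            (AlgebraicClosure (v.adicCompletion K))
            (Affine.Point.congrEquiv (baseChange_baseChange_adicCompletion W v).symm Q)))))
    (f : contOneCocycles (discreteTopRep (absoluteGaloisGroup (v.adicCompletion K))
      (localPoints W (v.adicCompletion K))))
    (hfB : ∀ τ, f.1 τ ∈ B)
    (hfI : ∀ τ ∈ 𝔐.inertia (absoluteGaloisGroup (v.adicCompletion K)), f.1 τ = 0) :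
    oneCocycleClass (discreteTopRep (absoluteGaloisGroup (v.adicCompletion K))
      (localPoints W (v.adicCompletion K))) f = 0 :=
  oneCocycleClass_eq_zero_of_hasMultiplicativeReductionAt_of_forall W hw hmult h𝔐 hι hC f
    (fun σ ↦ hB _ (hfB σ)) hfI

end Summit.BirchSwinnertonDyer.Rank1Residual.X11b.Three.UnramifiedNode

end
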